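import Summits.QuantumFields.BalabanUV.T4Continuum.Support.SmallFieldDomainsMetric

/-!
# T⁴ programme, SUBSTRATE — `Support/SmallFieldDomainsMetricSchur`: the SCHUR ∕ ROW-SUM JUNCTION between the index-weighted sup-norm
# classes `WSupLe` of [Balaban1985BackgroundPropagators] (3.41) — how LOCAL kernel bounds with decay in the multiscale distance become
# GLOBAL boundedness «`|Kλ|_{(α)} ≤ C·|λ|_{(β)}`» — plus the p. 398 EXCHANGE OF POWERS between two localization indices and the
# ASSEMBLED (3.42)-shape ⇒ (3.47)-shape junction

Audit cell `pub-balaban`, SUBSTRATE cell seat p4 (focus «multiscale norms»; map item P4-6 of `substrate/SUBSTRATE-MAP.md` v0.5 §4); companion of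
`Support/SmallFieldDomainsNorms` (`WSupLe`, `WSupLePrint`, `wSupLe_iff_ptIndex`) and `Support/SmallFieldDomainsMetric` (`msDistΩ`), same namespace.

WHAT IS PRINTED (documentation of the junction this file types; nothing printed is asserted).
* [Balaban1985BackgroundPropagators] T. Bałaban, *Propagators for lattice gauge theories in a background field*, Commun. Math. Phys. **99**
  (1985) 389–434, p. 398 (held text `paper:balaban1985-cmp99-background-propagators` p. 10), after the global inequalities (3.47)
  «|G′(U)λ|_{(2+γ)}, … ≦ B₀|λ|_{(γ)}»: *"Next, the choice of powers L^jη is conventional also. Using Lemma 2.1 in [4] we may replace the factor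
  (L^jη)^α by (L^jη)^β(L^{j′}η)^γ with β + γ = α, j, j′ are indices of localizations. It is easy to see that the global inequalities (3.47)
  are consequences of the local ones (3.42) and Lemma 2.1."* — (3.42) p. 397 (render `…-p009-x2.png`) being the LOCAL bounds *"|(G′(U)λ)(x)|,
  |(∇_U G′(U)λ)(x)|, |(G′(U)∇*_U λ)(x)|, |(Δ_U G′(U)λ)(x)| ≦ B₀[(L^jη)², L^jη, L^jη, 1]e^{−δ₀d(y,y′)}|λ| for x ∈ Δ(y), y ∈ Λ_j, supp λ ⊂ Δ(y′);
  (3.42)"* with, same page, *"Let us recall that if y ∈ Λ_j, then Δ(y) = B^j(y)"* (the level-`j` BLOCK of `y` — the blocks of §2b) and `d` the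
  weighted distance of [4] (2.46) (this tree's reading: `msDistΩ`).
* [4] = [Balaban1984PropagatorsII] T. Bałaban, *Propagators and renormalization transformations for lattice gauge theories. II*, Commun.
  Math. Phys. **96** (1984) 223–250, Lemma 2.1 p. 234 (read AS AN IMAGE on the render `…1984-cmp96-propagators-rt-II-p012-x2.png`): *"For the
  numbers α, 0 < α < 1, c₁(α) = 12c₀^d(½α), and RM satisfying (2.59) we have e^{−αδ₀d(y,y′)} ≦ e^{−αδ₀RM max{|j−j′|−1,0}}, y ∈ Λ_j,
  y′ ∈ Λ_{j′}, (2.60)  sup_{y∈𝔅} Σ_{y′∈𝔅} e^{−αδ₀d(y,y′)} ≦ c₁(α), (2.61)"* (and the iterates (2.62)–(2.63)).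
WHAT THIS FILE PROVIDES (all `[folklore]`; STRUCTURAL — the row-sum bound (2.61) and the separation (2.60) enter as HYPOTHESIS SHAPES, the
local kernel bound as a MAJORANT `a x x′ ≥ 0`; no Green's function, no estimate):
 * §1 the two-weight SCHUR ∕ ROW-SUM TEST on a `Finset` (`schur_row`): `p ≤ Σ a·u`, `v·u ≤ B` termwise, `w·Σ a·v⁻¹ ≤ C` ⇒ `w·p ≤ C·B`; and the
   two normed dischargers of the majorant hypothesis — a scalar kernel `Σ_{x′} A x x′ • f x′` and an operator kernel `Σ_{x′} A x x′ (f x′)`;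
 * §2 **THE JUNCTION** `WSupLe.of_rowSum`: for a big-block domain sequence, a finite `S ⊆ Ω₀`, a majorant `‖P x‖ ≤ Σ_{x′∈S} a x x′·‖f x′‖` on `Ω₀`
   and the ROW-SUM hypothesis with the (3.41) weights read at the point index, `(s j)^α · Σ_{x′∈S} a x x′ · (s (ι x′))^{−β} ≤ C` on the layer `j`,
   one gets `WSupLe s Ω β f B → WSupLe s Ω α P (C·B)` (two exponents: the (3.47) shape; print-indexed twin `WSupLePrint.of_rowSum`; abstract
   core `wSupLe_of_rowSum_sizes` with input SIZES `u`); §2b the BLOCKWISE form `WSupLe.of_blockRowSum` — the honest reading of (3.42)'s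
   «supp λ ⊂ Δ(y′)»: `P` majorized through every blockwise majorant `u` of `f` over the `L^{ι(x′)}`-blocks of representatives `x′ ∈ S`, the
   blocks lying in the layer of their index (`mem_layer_of_cubeIdx_eq`: LAYERS ARE UNIONS OF LEVEL BLOCKS);
 * §3 the p. 398 EXCHANGE OF POWERS: under a (2.60)-SHAPE separation `D·(|j − j′| − 1) ≤ t` (`D > 0`) and geometric scales, the ratio
   `(L^{j′}/L^j)^γ` is absorbed by decay: `(L^{j′}/L^j)^γ · e^{−δt} ≤ L^{|γ|} · e^{−(δ − |γ|·log L/D)·t}` (`exchange_powers`);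
 * §4 **THE ASSEMBLED JUNCTION** `WSupLePrint.of_localDecay`: geometric scales, a (2.60)-shape separation hypothesis, a (3.42)-shape blockwise
   local decay majorant `B₀(s (ι x))^σ e^{−δ₀ dist}` and a (2.61)-shape row sum at the reduced rate `δ₀ − |γ| log L/D` give
   `WSupLePrint s Ω γ f B → WSupLePrint s Ω (σ+γ) P (B₀·L^{|γ|}·C₁·B)` — the (3.47) shape «|G′λ|_{(2+γ)} ≦ B₀′|λ|_{(γ)}» (`σ = 2`).
   (The exponential row sum from a DENSITY count lives in the sibling `Support/SmallFieldDomainsRowSum`.)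
«P4-6 COSTED» (journal): (2.61) itself is [4]'s 1½-page surface-crossing count (pp. 231–233) — a cited estimate, not layer combinatorics —
hence a HYPOTHESIS SHAPE here (row sum ∕ density), never proved; the (2.60) separation from `BigDomainSeq.sep` is region geometry and is
PROVED separately for `msDistΩ` (`Support/SmallFieldDomainsMetricSep.indexSep_msDistΩ`).
RELATED TREE MODULES (not imported, nothing of them restated; different carriers).  The ABSTRACT-CARRIER reading of [4] Sect. A lives under
`Literature/…/Balaban1983to89/`: `B6RandomWalk.Ineq260 ∕ Ineq261` (the displays (2.60) ∕ (2.61) over `B6.Geometry`), `B6Geometry.dist246`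
((2.46) as the admissible-bond graph distance of a `ContourSystem`, with (2.54) and `levelGap_dist` ⇒ (2.60)), `B6Lemma21Counterexample` ∕
`B6Lemma21Repaired` (the PRINTED constant `c₁(α) = 12c₀^d(½α)` of (2.61) is exceeded in `d = 4`; repaired `13c₀(½α)^{3d}` — so any consumer of
§4's row-sum hypothesis should take the constant as a parameter, as done here), and `B9FromB6.ResidualGAGlobAtOne` ∕ cell GAPS G-B9-03a
(the (3.47)-from-(3.42) derivation is NOT printed — this file types its MECHANISM on the substrate's `ℤ^d` classes; it does NOT discharge that
abstract residual, whose carrier is `B9.Geometry`).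
HONEST FRAMING (T4-DAG p. 1).  Norm∕kernel BOOKKEEPING (real analysis on finite sums); no configuration, no propagator, no estimate of any NE
row; spine 0/9 unchanged; NOT infinite volume, NOT a mass gap, NOT Clay.  HONEST DEPENDENCY: continuum YM on T⁴ ⇐ BetaPertH ∧ nine spine
estimates (0/9 proved); BetaPertH ⇐ (D1) ∧ (D4) ∧ CAP+tail; G-an2-4 gates asym, D1 and NE2/3/4.  No `sorry`.
-/

noncomputable section

open scoped BigOperators

namespace Summit.QuantumFields.BalabanUV.T4Continuum.SmallFieldDomains

open Literature.MathematicalPhysics.QuantumFieldTheory.Balaban1983to89.B14DomainGeom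

variable {d : ℕ}

/-! ## §1 The two-weight Schur ∕ row-sum test -/

section Schur
variable {ι : Type*}

/-- **THE WEIGHTED SCHUR (ROW-SUM) TEST, ONE ROW**: if `p ≤ Σ_{i∈S} a i · u i` with `a ≥ 0` (a kernel row majorizing an output value `p` by
input sizes `u`), the inputs obey `v i · u i ≤ B` (`v > 0` the input weight, `0 ≤ B`), and the weighted row sum obeys `w · Σ_{i∈S} a i · (v i)⁻¹ ≤ C`
(`0 ≤ w` the output weight), then `w · p ≤ C · B`. [folklore] -/
theorem schur_row (S : Finset ι) {a v u : ι → ℝ} {w p B C : ℝ} (ha : ∀ i ∈ S, 0 ≤ a i) (hv : ∀ i ∈ S, 0 < v i)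
    (hw : 0 ≤ w) (hB : 0 ≤ B) (hp : p ≤ ∑ i ∈ S, a i * u i) (hu : ∀ i ∈ S, v i * u i ≤ B)
    (hrow : w * ∑ i ∈ S, a i * (v i)⁻¹ ≤ C) : w * p ≤ C * B := by
  have h1 : ∑ i ∈ S, a i * u i ≤ B * ∑ i ∈ S, a i * (v i)⁻¹ := by
    rw [Finset.mul_sum]
    refine Finset.sum_le_sum fun i hi => ?_
    have hvi := hv i hi
    calc a i * u i = a i * (v i)⁻¹ * (v i * u i) := by field_simp
      _ ≤ a i * (v i)⁻¹ * B := mul_le_mul_of_nonneg_left (hu i hi) (mul_nonneg (ha i hi) (inv_nonneg.mpr hvi.le))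
      _ = B * (a i * (v i)⁻¹) := by ring
  calc w * p ≤ w * (B * ∑ i ∈ S, a i * (v i)⁻¹) := mul_le_mul_of_nonneg_left (hp.trans h1) hw
    _ = B * (w * ∑ i ∈ S, a i * (v i)⁻¹) := by ring
    _ ≤ B * C := mul_le_mul_of_nonneg_left hrow hB
    _ = C * B := mul_comm _ _

/-- SCALAR-KERNEL DISCHARGER of the majorant hypothesis: `‖Σ_{i∈S} A i • f i‖ ≤ Σ_{i∈S} ‖A i‖·‖f i‖`. [folklore] -/
theorem norm_sum_smul_le {𝕜 E : Type*} [NormedField 𝕜] [SeminormedAddCommGroup E] [NormedSpace 𝕜 E] (S : Finset ι) (A : ι → 𝕜)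
    (f : ι → E) : ‖∑ i ∈ S, A i • f i‖ ≤ ∑ i ∈ S, ‖A i‖ * ‖f i‖ :=
  (norm_sum_le _ _).trans (Finset.sum_le_sum fun _ _ => (norm_smul_le _ _))

/-- OPERATOR-KERNEL DISCHARGER of the majorant hypothesis: `‖Σ_{i∈S} A i (f i)‖ ≤ Σ_{i∈S} ‖A i‖·‖f i‖` (operator norms). [folklore] -/
theorem norm_sum_clm_le {𝕜 E F : Type*} [NontriviallyNormedField 𝕜] [SeminormedAddCommGroup E] [NormedSpace 𝕜 E]
    [SeminormedAddCommGroup F] [NormedSpace 𝕜 F] (S : Finset ι) (A : ι → E →L[𝕜] F) (f : ι → E) :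
    ‖∑ i ∈ S, A i (f i)‖ ≤ ∑ i ∈ S, ‖A i‖ * ‖f i‖ :=
  (norm_sum_le _ _).trans (Finset.sum_le_sum fun i _ => (A i).le_opNorm (f i))

end Schur

/-! ## §2 The junction between the `WSupLe` classes -/

section Junction
variable {L M₁ R k : ℕ} {Ω : ℕ → Set (Pt d)} {s : ℕ → ℝ} {E G : Type*} [SeminormedAddCommGroup E] [SeminormedAddCommGroup G]
  {f : Pt d → E} {P : Pt d → G} {a : Pt d → Pt d → ℝ} {α β : ℤ} {B C : ℝ}

/-- **CORE (abstract input sizes)**: for a big-block domain sequence with positive scales and point index `ι = ptIndex k Ω`, a finite `S`, a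
majorant `‖P x‖ ≤ Σ_{x′∈S} a x x′ · u x′` on `Ω₀` (`a ≥ 0`) by input SIZES `u` obeying `(s (ι x′))^β · u x′ ≤ B` on `S` (`0 ≤ B`), and the ROW SUM
`(s j)^α · Σ_{x′∈S} a x x′ · ((s (ι x′))^β)⁻¹ ≤ C` on the layer `j`: `WSupLe s Ω α P (C·B)`. [folklore] -/
theorem wSupLe_of_rowSum_sizes (hΩ : BigDomainSeq L M₁ R k Ω) (hs : ∀ j, 0 < s j) (S : Finset (Pt d)) {u : Pt d → ℝ}
    (ha : ∀ x x', 0 ≤ a x x') (hB : 0 ≤ B) (hP : ∀ x, x ∈ Ω 0 → ‖P x‖ ≤ ∑ x' ∈ S, a x x' * u x')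
    (hu : ∀ x' ∈ S, s (ptIndex k Ω x') ^ β * u x' ≤ B)
    (hrow : ∀ j x, x ∈ layer Ω j → s j ^ α * ∑ x' ∈ S, a x x' * (s (ptIndex k Ω x') ^ β)⁻¹ ≤ C) :
    WSupLe s Ω α P (C * B) := by
  intro j x hx
  have hx0 : x ∈ Ω 0 := mem_zero_of_mem_layer hΩ hx
  exact schur_row S (fun x' _ => ha x x') (fun x' _ => zpow_pos (hs _) β) (zpow_pos (hs j) α).le hB (hP x hx0) hu (hrow j x hx)

/-- **THE SCHUR JUNCTION BETWEEN THE (3.41) CLASSES, POINTWISE FORM** ([B9] p. 398: *"the global inequalities (3.47) are consequences of the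
local ones (3.42) and Lemma 2.1"*, typed as the row-sum test with the (3.41) weights).  Let `Ω` be a big-block domain sequence with point index
`ι = ptIndex k Ω` and positive scales `s`, `S ⊆ Ω₀` finite, and suppose: (i) MAJORANT — `‖P x‖ ≤ Σ_{x′∈S} a x x′ · ‖f x′‖` on `Ω₀` with `a ≥ 0`
(e.g. `P = Kf` for a kernel `K` supported in `S` with `‖K x x′‖ ≤ a x x′`, §1 dischargers); (ii) ROW SUM — on the layer `j`,
`(s j)^α · Σ_{x′∈S} a x x′ · ((s (ι x′))^β)⁻¹ ≤ C`.  Then `|f|_{β} ≤ B ⇒ |P|_{α} ≤ C·B`: `WSupLe s Ω β f B → WSupLe s Ω α P (C·B)` (`0 ≤ B`;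
exponents in this tree's decay convention, two of them — the (3.47) shape). [folklore] -/
theorem WSupLe.of_rowSum (hΩ : BigDomainSeq L M₁ R k Ω) (hs : ∀ j, 0 < s j) (S : Finset (Pt d)) (hS : ∀ x' ∈ S, x' ∈ Ω 0)
    (ha : ∀ x x', 0 ≤ a x x') (hB : 0 ≤ B) (hP : ∀ x, x ∈ Ω 0 → ‖P x‖ ≤ ∑ x' ∈ S, a x x' * ‖f x'‖)
    (hrow : ∀ j x, x ∈ layer Ω j → s j ^ α * ∑ x' ∈ S, a x x' * (s (ptIndex k Ω x') ^ β)⁻¹ ≤ C)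
    (hf : WSupLe s Ω β f B) : WSupLe s Ω α P (C * B) :=
  have hfι := (wSupLe_iff_ptIndex (s := s) (α := β) (A := f) (C := B) hΩ).mp hf
  wSupLe_of_rowSum_sizes hΩ hs S ha hB hP (fun x' hx' => hfι x' (hS x' hx')) hrow

/-- The same junction with the row sum read AT THE POINT INDEX on both sides (one inequality per point of `Ω₀`):
`(s (ι x))^α · Σ_{x′∈S} a x x′ · ((s (ι x′))^β)⁻¹ ≤ C` for `x ∈ Ω₀`. [folklore] -/
theorem WSupLe.of_rowSum_ptIndex (hΩ : BigDomainSeq L M₁ R k Ω) (hs : ∀ j, 0 < s j) (S : Finset (Pt d))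
    (hS : ∀ x' ∈ S, x' ∈ Ω 0) (ha : ∀ x x', 0 ≤ a x x') (hB : 0 ≤ B)
    (hP : ∀ x, x ∈ Ω 0 → ‖P x‖ ≤ ∑ x' ∈ S, a x x' * ‖f x'‖)
    (hrow : ∀ x, x ∈ Ω 0 → s (ptIndex k Ω x) ^ α * ∑ x' ∈ S, a x x' * (s (ptIndex k Ω x') ^ β)⁻¹ ≤ C)
    (hf : WSupLe s Ω β f B) : WSupLe s Ω α P (C * B) := by
  refine WSupLe.of_rowSum hΩ hs S hS ha hB hP (fun j x hx => ?_) hf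
  have hx0 : x ∈ Ω 0 := mem_zero_of_mem_layer hΩ hx
  have hj : ptIndex k Ω x = j := (mem_layer_iff_ptIndex hΩ hx0).mp hx
  simpa only [hj] using hrow x hx0

/-- SAME EXPONENT on both sides: the classical weighted Schur test `|P|_{α} ≤ C·|f|_{α}` from `(s j)^α·Σ_{x′} a x x′·(s (ι x′))^{−α} ≤ C`. [folklore] -/
theorem WSupLe.of_rowSum_same (hΩ : BigDomainSeq L M₁ R k Ω) (hs : ∀ j, 0 < s j) (S : Finset (Pt d)) (hS : ∀ x' ∈ S, x' ∈ Ω 0)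
    (ha : ∀ x x', 0 ≤ a x x') (hB : 0 ≤ B) (hP : ∀ x, x ∈ Ω 0 → ‖P x‖ ≤ ∑ x' ∈ S, a x x' * ‖f x'‖)
    (hrow : ∀ j x, x ∈ layer Ω j → s j ^ α * ∑ x' ∈ S, a x x' * (s (ptIndex k Ω x') ^ α)⁻¹ ≤ C)
    (hf : WSupLe s Ω α f B) : WSupLe s Ω α P (C * B) :=
  WSupLe.of_rowSum hΩ hs S hS ha hB hP hrow hf

/-- **PRINT-INDEXED TWIN** (literally the (3.47) shape «`|Kλ|_{(α′)} ≦ C·|λ|_{(β′)}`», e.g. `α′ = 2 + γ`, `β′ = γ`): with the row sum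
`(s j)^{−α′} · Σ_{x′∈S} a x x′ · (s (ι x′))^{β′} ≤ C` on the layer `j` — for (3.42)'s majorant `a = B₀(s j)²e^{−δ₀d}` this reads
`B₀ · Σ_{x′} (s (ι x′)/s j)^{γ} e^{−δ₀d(x,x′)} ≤ C` — one gets `WSupLePrint s Ω β′ f B → WSupLePrint s Ω α′ P (C·B)`. [folklore] -/
theorem WSupLePrint.of_rowSum (hΩ : BigDomainSeq L M₁ R k Ω) (hs : ∀ j, 0 < s j) (S : Finset (Pt d)) (hS : ∀ x' ∈ S, x' ∈ Ω 0)
    (ha : ∀ x x', 0 ≤ a x x') (hB : 0 ≤ B) (hP : ∀ x, x ∈ Ω 0 → ‖P x‖ ≤ ∑ x' ∈ S, a x x' * ‖f x'‖) {α' β' : ℤ}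
    (hrow : ∀ j x, x ∈ layer Ω j → s j ^ (-α') * ∑ x' ∈ S, a x x' * s (ptIndex k Ω x') ^ β' ≤ C)
    (hf : WSupLePrint s Ω β' f B) : WSupLePrint s Ω α' P (C * B) := by
  rw [wSupLePrint_iff] at hf ⊢
  refine WSupLe.of_rowSum hΩ hs S hS ha hB hP (fun j x hx => ?_) hf
  have h := hrow j x hx
  simpa only [zpow_neg, inv_inv] using h

/-! ### §2b The blockwise form — (3.42)'s «supp λ ⊂ Δ(y′)» reading -/

/-- LAYERS ARE UNIONS OF LEVEL BLOCKS: for a big-block domain sequence, a point in the same `L^j`-block as a point of the layer `j` lies in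
the layer `j` (`Ω_j` and `Ω_{j+1}` are both unions of `L^j`-blocks, `BigDomainSeq.blocks_le`) — so [B9]'s localization blocks `Δ(y) = B^j(y)`,
`y ∈ Λ_j` (p. 397), sit inside the layer of their index. [folklore] -/
theorem mem_layer_of_cubeIdx_eq (hΩ : BigDomainSeq L M₁ R k Ω) {j : ℕ} {x x' : Pt d} (hx : x ∈ layer Ω j)
    (h : cubeIdx (L ^ j) x' = cubeIdx (L ^ j) x) : x' ∈ layer Ω j := by
  have h1 : x' ∈ Ω j ↔ x ∈ Ω j := hΩ.blocks_le le_rfl x' x h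
  have h2 : x' ∈ Ω (j + 1) ↔ x ∈ Ω (j + 1) := hΩ.blocks_le (Nat.le_succ j) x' x h
  rw [mem_layer] at hx ⊢
  exact ⟨h1.mpr hx.1, fun h' => hx.2 (h2.mp h')⟩

/-- The level block of a point of `Ω₀` (side `L^{ι(x′)}`) lies in the layer of its index, hence in `Ω₀`, and all its points have the index
`ι(x′)`. [folklore] -/
theorem ptIndex_eq_of_cubeIdx_ptIndex_eq (hΩ : BigDomainSeq L M₁ R k Ω) {x' x'' : Pt d} (hx' : x' ∈ Ω 0)
    (h : cubeIdx (L ^ ptIndex k Ω x') x'' = cubeIdx (L ^ ptIndex k Ω x') x') :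
    x'' ∈ layer Ω (ptIndex k Ω x') ∧ ptIndex k Ω x'' = ptIndex k Ω x' := by
  have hlay : x'' ∈ layer Ω (ptIndex k Ω x') := mem_layer_of_cubeIdx_eq hΩ (mem_layer_ptIndex hΩ hx') h
  exact ⟨hlay, (mem_layer_iff_ptIndex hΩ (mem_zero_of_mem_layer hΩ hlay)).mp hlay⟩

/-- **THE SCHUR JUNCTION, BLOCKWISE FORM** — the honest reading of (3.42) «|(G′λ)(x)| ≦ a(x, y′)·|λ| for supp λ ⊂ Δ(y′)» summed over a block
decomposition of `λ`: the majorant hypothesis is now that `‖P x‖ ≤ Σ_{x′∈S} a x x′ · u x′` for EVERY blockwise majorant `u` of `f` (`‖f x″‖ ≤ u x′`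
for all `x″` in the `L^{ι(x′)}`-block of the representative `x′ ∈ S ⊆ Ω₀` — e.g. `S` = one base point per block `B^{j′}(y′) = Δ(y′)`), the row
sum is as before, and the conclusion is the same `WSupLe s Ω β f B → WSupLe s Ω α P (C·B)`: the (3.41) bound on `f` IS a blockwise majorant
(`u x′ = B·(s (ι x′))^{−β}`), the block lying in the layer of its index (`ptIndex_eq_of_cubeIdx_ptIndex_eq`). [folklore] -/
theorem WSupLe.of_blockRowSum (hΩ : BigDomainSeq L M₁ R k Ω) (hs : ∀ j, 0 < s j) (S : Finset (Pt d)) (hS : ∀ x' ∈ S, x' ∈ Ω 0)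
    (ha : ∀ x x', 0 ≤ a x x') (hB : 0 ≤ B)
    (hP : ∀ x, x ∈ Ω 0 → ∀ u : Pt d → ℝ,
      (∀ x' ∈ S, ∀ x'', cubeIdx (L ^ ptIndex k Ω x') x'' = cubeIdx (L ^ ptIndex k Ω x') x' → ‖f x''‖ ≤ u x') →
        ‖P x‖ ≤ ∑ x' ∈ S, a x x' * u x')
    (hrow : ∀ j x, x ∈ layer Ω j → s j ^ α * ∑ x' ∈ S, a x x' * (s (ptIndex k Ω x') ^ β)⁻¹ ≤ C)
    (hf : WSupLe s Ω β f B) : WSupLe s Ω α P (C * B) := by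
  -- the (3.41) bound is a blockwise majorant with sizes `u x′ = B·((s (ι x′))^β)⁻¹`
  set u : Pt d → ℝ := fun x' => B * (s (ptIndex k Ω x') ^ β)⁻¹ with hu
  have hmaj : ∀ x' ∈ S, ∀ x'', cubeIdx (L ^ ptIndex k Ω x') x'' = cubeIdx (L ^ ptIndex k Ω x') x' → ‖f x''‖ ≤ u x' := by
    intro x' hx' x'' hblk
    obtain ⟨hlay, _⟩ := ptIndex_eq_of_cubeIdx_ptIndex_eq hΩ (hS x' hx') hblk
    have h1 := hf.norm_le hs hlay
    simpa only [hu, zpow_neg] using h1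
  refine wSupLe_of_rowSum_sizes hΩ hs S ha hB (fun x hx0 => hP x hx0 u hmaj) (fun x' _ => ?_) hrow
  have hpos : 0 < s (ptIndex k Ω x') ^ β := zpow_pos (hs _) β
  rw [hu, ← mul_assoc, mul_comm (s _ ^ β), mul_assoc, mul_inv_cancel₀ hpos.ne', mul_one]

/-- Print-indexed twin of the blockwise form. [folklore] -/
theorem WSupLePrint.of_blockRowSum (hΩ : BigDomainSeq L M₁ R k Ω) (hs : ∀ j, 0 < s j) (S : Finset (Pt d))
    (hS : ∀ x' ∈ S, x' ∈ Ω 0) (ha : ∀ x x', 0 ≤ a x x') (hB : 0 ≤ B)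
    (hP : ∀ x, x ∈ Ω 0 → ∀ u : Pt d → ℝ,
      (∀ x' ∈ S, ∀ x'', cubeIdx (L ^ ptIndex k Ω x') x'' = cubeIdx (L ^ ptIndex k Ω x') x' → ‖f x''‖ ≤ u x') →
        ‖P x‖ ≤ ∑ x' ∈ S, a x x' * u x') {α' β' : ℤ}
    (hrow : ∀ j x, x ∈ layer Ω j → s j ^ (-α') * ∑ x' ∈ S, a x x' * s (ptIndex k Ω x') ^ β' ≤ C)
    (hf : WSupLePrint s Ω β' f B) : WSupLePrint s Ω α' P (C * B) := by
  rw [wSupLePrint_iff] at hf ⊢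
  refine WSupLe.of_blockRowSum hΩ hs S hS ha hB hP (fun j x hx => ?_) hf
  have h := hrow j x hx
  simpa only [zpow_neg, inv_inv] using h

end Junction

/-! ## §3 The exchange of powers between two localization indices ([B9] p. 398 via [B6] (2.60)) -/

section Exchange

/-- Integer bookkeeping: `γ·(j′ − j) ≤ |γ|·|j − j′|`. [folklore] -/
theorem int_mul_sub_le_natAbs (γ : ℤ) (j j' : ℕ) :
    γ * ((j' : ℤ) - j) ≤ ((γ.natAbs * ((j : ℤ) - j').natAbs : ℕ) : ℤ) := by
  have h1 : γ * ((j' : ℤ) - j) ≤ |γ * ((j' : ℤ) - j)| := le_abs_self _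
  rw [abs_mul] at h1
  have h2 : |(j' : ℤ) - j| = |(j : ℤ) - j'| := abs_sub_comm _ _
  rw [h2] at h1
  push_cast
  exact h1

/-- For `1 ≤ L`: `(L^{j′}/L^{j})^γ ≤ L^{|γ|·|j−j′|}`. [folklore] -/
theorem div_pow_zpow_le {Lr : ℝ} (hL : 1 ≤ Lr) (γ : ℤ) (j j' : ℕ) :
    (Lr ^ j' / Lr ^ j) ^ γ ≤ Lr ^ (γ.natAbs * ((j : ℤ) - j').natAbs) := by
  have hL0 : 0 < Lr := lt_of_lt_of_le one_pos hL
  have e1 : Lr ^ j' / Lr ^ j = Lr ^ ((j' : ℤ) - j) := by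
    rw [zpow_sub₀ hL0.ne', zpow_natCast, zpow_natCast]
  rw [e1, ← zpow_mul, ← zpow_natCast]
  refine zpow_le_zpow_right₀ hL ?_
  rw [mul_comm]
  exact int_mul_sub_le_natAbs γ j j'

/-- **EXCHANGE OF POWERS** ([B9] p. 398 *"we may replace the factor (L^jη)^α by (L^jη)^β(L^{j′}η)^γ with β + γ = α"*, the mechanism being
[B6] (2.60)): if the distance-like quantity `t ≥ 0` between a point of index `j` and a point of index `j′` satisfies the (2.60)-SHAPE
separation `D·(|j − j′| − 1) ≤ t` with `D > 0`, then for `1 ≤ L` and any integer `γ` the scale ratio is absorbed by a loss of decay rate: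
`(L^{j′}/L^{j})^γ · e^{−δt} ≤ L^{|γ|} · e^{−(δ − |γ|·log L / D)·t}`. [folklore] -/
theorem exchange_powers {Lr D t δ : ℝ} (hL : 1 ≤ Lr) (hD : 0 < D) (ht : 0 ≤ t) (γ : ℤ) (j j' : ℕ)
    (hsep : D * ((((j : ℤ) - j').natAbs : ℝ) - 1) ≤ t) :
    (Lr ^ j' / Lr ^ j) ^ γ * Real.exp (-(δ * t)) ≤
      Lr ^ γ.natAbs * Real.exp (-((δ - γ.natAbs * Real.log Lr / D) * t)) := by
  have hL0 : 0 < Lr := lt_of_lt_of_le one_pos hL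
  have hlog : 0 ≤ Real.log Lr := Real.log_nonneg hL
  set m : ℕ := γ.natAbs with hm
  set n : ℕ := ((j : ℤ) - j').natAbs with hn
  -- step 1: the ratio is at most `L^{m n}`
  have h1 : (Lr ^ j' / Lr ^ j) ^ γ ≤ Lr ^ (m * n) := div_pow_zpow_le hL γ j j'
  -- step 2: `L^{m n} ≤ L^m · exp (m log L · t / D)` from `n − 1 ≤ t / D`
  have h2 : Lr ^ (m * n) ≤ Lr ^ m * Real.exp (m * Real.log Lr / D * t) := by
    have hmn : (Lr ^ (m * n) : ℝ) ≤ Lr ^ m * Lr ^ (m * (n - 1)) := by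
      rw [← pow_add]
      refine pow_le_pow_right₀ hL ?_
      rcases n with _ | n
      · simp
      · simp [Nat.mul_succ, add_comm]
    refine hmn.trans (mul_le_mul_of_nonneg_left ?_ (pow_nonneg hL0.le m))
    have e2 : (Lr ^ (m * (n - 1)) : ℝ) = Real.exp ((m * (n - 1 : ℕ) : ℝ) * Real.log Lr) := by
      rw [← Real.exp_log (pow_pos hL0 _), Real.log_pow]
      push_cast
      ring_nf
    rw [e2]
    refine Real.exp_le_exp.mpr ?_
    have hn1 : ((n - 1 : ℕ) : ℝ) ≤ t / D := by
      rw [le_div_iff₀ hD]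
      rcases n with _ | n
      · simp only [Nat.zero_sub, Nat.cast_zero, zero_mul]; exact ht
      · have : ((n + 1 - 1 : ℕ) : ℝ) = ((n + 1 : ℕ) : ℝ) - 1 := by push_cast; ring
        rw [this, mul_comm]
        exact hsep
    have hmlog : 0 ≤ (m : ℝ) * Real.log Lr := mul_nonneg (Nat.cast_nonneg m) hlog
    calc (m : ℝ) * ((n - 1 : ℕ) : ℝ) * Real.log Lr = ((n - 1 : ℕ) : ℝ) * (m * Real.log Lr) := by ring
      _ ≤ t / D * (m * Real.log Lr) := mul_le_mul_of_nonneg_right hn1 hmlog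
      _ = m * Real.log Lr / D * t := by ring
  -- assemble
  have hexp : 0 ≤ Real.exp (-(δ * t)) := (Real.exp_pos _).le
  calc (Lr ^ j' / Lr ^ j) ^ γ * Real.exp (-(δ * t)) ≤ Lr ^ m * Real.exp (m * Real.log Lr / D * t) * Real.exp (-(δ * t)) :=
        mul_le_mul_of_nonneg_right (h1.trans h2) hexp
    _ = Lr ^ m * Real.exp (-((δ - m * Real.log Lr / D) * t)) := by
        rw [mul_assoc, ← Real.exp_add]; congr 1; congr 1; ring

/-- The exchange read on SCALES `s j = c·L^j` (`c > 0`, e.g. `c = η` or `c = L^{−k}`): `(s j′/s j)^γ · e^{−δt} ≤ L^{|γ|}·e^{−(δ − |γ|log L/D)t}`.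
[folklore] -/
theorem exchange_powers_scale {Lr D t δ c : ℝ} (hL : 1 ≤ Lr) (hc : 0 < c) (hD : 0 < D) (ht : 0 ≤ t) (γ : ℤ) (j j' : ℕ)
    (hsep : D * ((((j : ℤ) - j').natAbs : ℝ) - 1) ≤ t) :
    (c * Lr ^ j' / (c * Lr ^ j)) ^ γ * Real.exp (-(δ * t)) ≤
      Lr ^ γ.natAbs * Real.exp (-((δ - γ.natAbs * Real.log Lr / D) * t)) := by
  have hL0 : 0 < Lr := lt_of_lt_of_le one_pos hL
  have e1 : c * Lr ^ j' / (c * Lr ^ j) = Lr ^ j' / Lr ^ j := by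
    rw [mul_div_mul_left _ _ hc.ne']
  rw [e1]
  exact exchange_powers hL hD ht γ j j' hsep

/-- THE ROW-SUM REDUCTION the exchange buys (one row, print exponents): if on the row of a point of index `j` the majorant is the (3.42)-shape
`a x′ = B₀ · (s j)^{α′−β′}… ` — abstractly: if termwise `(s j)^{−α′}·a i·(s (ι i))^{β′} ≤ K · e^{−δ′·t i}` (what `exchange_powers` delivers with
`K = B₀L^{|γ|}`, `δ′ = δ₀ − |γ|log L/D`), then the weighted row sum is at most `K · Σ_i e^{−δ′ t i}` — the (2.61)-type sum of §4. [folklore] -/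
theorem rowSum_le_of_termwise {ι : Type*} (S : Finset ι) {g e : ι → ℝ} {w K : ℝ}
    (h : ∀ i ∈ S, w * g i ≤ K * e i) : w * ∑ i ∈ S, g i ≤ K * ∑ i ∈ S, e i := by
  rw [Finset.mul_sum, Finset.mul_sum]
  exact Finset.sum_le_sum h

end Exchange

/-! ## §4 The assembled junction: a (3.42)-shape local decay bound gives a (3.47)-shape global bound -/

section Assembled
variable {L M₁ R k : ℕ} {Ω : ℕ → Set (Pt d)} {s : ℕ → ℝ} {E G : Type*} [SeminormedAddCommGroup E] [SeminormedAddCommGroup G]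
  {f : Pt d → E} {P : Pt d → G}

/-- zpow bookkeeping of the (3.41) weights against a (3.42)-shape prefactor: `(s j)^{−(σ+γ)}·(B₀(s j)^σ·e)·(s j′)^γ = B₀·(s j′/s j)^γ·e`. [folklore] -/
theorem weight_prefactor_eq {sj sj' B₀ e : ℝ} (hsj : 0 < sj) (σ γ : ℤ) :
    sj ^ (-(σ + γ)) * (B₀ * sj ^ σ * e * sj' ^ γ) = B₀ * ((sj' / sj) ^ γ * e) := by
  rw [div_zpow, neg_add, zpow_add₀ hsj.ne', zpow_neg, zpow_neg]
  field_simp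

/-- **THE ASSEMBLED JUNCTION — [B9] p. 398 «the global inequalities (3.47) are consequences of the local ones (3.42) and Lemma 2.1», typed on the
substrate's classes.**  DATA: a big-block domain sequence `Ω` with GEOMETRIC scales `s i = c·L^i` (`c > 0`, `1 ≤ L`), point index `ι`, a finite set
of block representatives `S ⊆ Ω₀`, a distance-like `dist ≥ 0`.  HYPOTHESES, all of printed SHAPE and none proved here: (2.60)-shape SEPARATION
`D·(|ι x − ι x′| − 1) ≤ dist x x′` (`D > 0`; for `dist = d_Ω` this is `SmallFieldDomainsMetricSep.indexSep_msDistΩ_ptIndex` with `D = RM₁/(2c)`);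
(3.42)-shape LOCAL DECAY — `‖P x‖ ≤ Σ_{x′∈S} B₀·(s (ι x))^σ·e^{−δ₀·dist x x′}·u x′` for every blockwise majorant `u` of `f` (`B₀ ≥ 0`; print:
`σ = 2` for `G′(U)`, `1` for `∇G′`, …); (2.61)-shape ROW SUM at the REDUCED rate `δ′ = δ₀ − |γ|·log L/D` — `Σ_{x′∈S} e^{−δ′·dist x x′} ≤ C₁` on
`Ω₀`.  CONCLUSION (print-indexed, (3.47)'s «|G′λ|_{(2+γ)} ≦ B₀′|λ|_{(γ)}»): `WSupLePrint s Ω γ f B → WSupLePrint s Ω (σ + γ) P (B₀·L^{|γ|}·C₁·B)`.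
(The row sum (2.61) is [B6] Lemma 2.1, a cited estimate — see the module docstring for the status of its printed constant.) [folklore] -/
theorem WSupLePrint.of_localDecay (hΩ : BigDomainSeq L M₁ R k Ω) {c : ℝ} (hc : 0 < c) (hL : 1 ≤ (L : ℝ))
    (hsc : ∀ i, s i = c * (L : ℝ) ^ i) (S : Finset (Pt d)) (hS : ∀ x' ∈ S, x' ∈ Ω 0) {dist : Pt d → Pt d → ℝ}
    (hdist : ∀ x x', 0 ≤ dist x x') {D : ℝ} (hD : 0 < D)
    (hsep : ∀ x, x ∈ Ω 0 → ∀ x' ∈ S, D * (((((ptIndex k Ω x : ℤ) - ptIndex k Ω x').natAbs : ℕ) : ℝ) - 1) ≤ dist x x')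
    {B₀ δ₀ : ℝ} (hB₀ : 0 ≤ B₀) {σ γ : ℤ}
    (hP : ∀ x, x ∈ Ω 0 → ∀ u : Pt d → ℝ,
      (∀ x' ∈ S, ∀ x'', cubeIdx (L ^ ptIndex k Ω x') x'' = cubeIdx (L ^ ptIndex k Ω x') x' → ‖f x''‖ ≤ u x') →
        ‖P x‖ ≤ ∑ x' ∈ S, B₀ * s (ptIndex k Ω x) ^ σ * Real.exp (-(δ₀ * dist x x')) * u x')
    {C₁ : ℝ} (hrow : ∀ x, x ∈ Ω 0 → ∑ x' ∈ S, Real.exp (-((δ₀ - γ.natAbs * Real.log L / D) * dist x x')) ≤ C₁)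
    {B : ℝ} (hB : 0 ≤ B) (hf : WSupLePrint s Ω γ f B) :
    WSupLePrint s Ω (σ + γ) P (B₀ * (L : ℝ) ^ γ.natAbs * C₁ * B) := by
  have hL0 : (0 : ℝ) < L := lt_of_lt_of_le one_pos hL
  have hs : ∀ i, 0 < s i := fun i => by rw [hsc i]; positivity
  -- the majorant `a x x′ = B₀ (s (ι x))^σ e^{−δ₀ dist x x′}`
  refine WSupLePrint.of_blockRowSum hΩ hs S hS (a := fun x x' => B₀ * s (ptIndex k Ω x) ^ σ * Real.exp (-(δ₀ * dist x x')))
    (fun x x' => by have := zpow_pos (hs (ptIndex k Ω x)) σ; positivity) hB (fun x hx u hu => hP x hx u hu) (fun j x hx => ?_) hf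
  -- the row of a point `x` of the layer `j`: `ι x = j`
  have hx0 : x ∈ Ω 0 := mem_zero_of_mem_layer hΩ hx
  have hιx : ptIndex k Ω x = j := (mem_layer_iff_ptIndex hΩ hx0).mp hx
  rw [Finset.mul_sum]
  -- termwise: weights against prefactor, then the exchange of powers
  have hterm : ∀ x' ∈ S, s j ^ (-(σ + γ)) * (B₀ * s (ptIndex k Ω x) ^ σ * Real.exp (-(δ₀ * dist x x')) * s (ptIndex k Ω x') ^ γ)
      ≤ B₀ * ((L : ℝ) ^ γ.natAbs * Real.exp (-((δ₀ - γ.natAbs * Real.log L / D) * dist x x'))) := by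
    intro x' hx'
    rw [hιx, weight_prefactor_eq (hs j) σ γ]
    refine mul_le_mul_of_nonneg_left ?_ hB₀
    rw [hsc, hsc]
    have hsep' := hsep x hx0 x' hx'
    rw [hιx] at hsep'
    exact exchange_powers_scale hL hc hD (hdist x x') γ j (ptIndex k Ω x') hsep'
  calc ∑ x' ∈ S, s j ^ (-(σ + γ)) * (B₀ * s (ptIndex k Ω x) ^ σ * Real.exp (-(δ₀ * dist x x')) * s (ptIndex k Ω x') ^ γ)
      ≤ ∑ x' ∈ S, B₀ * ((L : ℝ) ^ γ.natAbs * Real.exp (-((δ₀ - γ.natAbs * Real.log L / D) * dist x x'))) :=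
        Finset.sum_le_sum hterm
    _ = B₀ * (L : ℝ) ^ γ.natAbs * ∑ x' ∈ S, Real.exp (-((δ₀ - γ.natAbs * Real.log L / D) * dist x x')) := by
        rw [Finset.mul_sum]; exact Finset.sum_congr rfl fun _ _ => by ring
    _ ≤ B₀ * (L : ℝ) ^ γ.natAbs * C₁ := mul_le_mul_of_nonneg_left (hrow x hx0) (by positivity)

end Assembled

end Summit.QuantumFields.BalabanUV.T4Continuum.SmallFieldDomains

end
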